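import Literature.MathematicalPhysics.QuantumFieldTheory.Balaban1983to89.B14Eq338Concrete
import Literature.MathematicalPhysics.QuantumFieldTheory.Balaban1983to89.B14Eq334Contour

/-!
# `Balaban1983to89.B14.Eq334SpectralWindow` — [Balaban1988Convergent] p. 273 (between (3.34) and (3.35)): «where the
# contour γ surrounds the spectrum of C*Δ^{(k)}C, e.g. we take γ composed of a segment of the circle |z| = R for R large
# enough, and of an interval on the line Re z = r, r positive and small. We take λ₀ > r, but small enough» — THE SPECTRAL
# WINDOW OF C*Δ^{(k)}C FROM THE (2.157)-TYPE FORM LETTERS, the contour data of (3.34) WITH A MARGIN, and the λ₀-independent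
# per-bond size of the first bracket of (3.37) (cell gap G-B14s-11 read as a dictionary; lit-balaban desk answer N11,
# pub-ymgap INBOX 2026-08-26T01:41:05Z)

HONEST FRAMING (cell `pub-ymgap`, Track A DAG node N11 = [B14]; count-neutral SLOT input).  Finite-dimensional spectral
bookkeeping over a real symmetric matrix `T` (print's `C*Δ^{(k)}C` on the finitely many fluctuation variables of
`Λ^{(k)*}_{k+1}`) + tree theorems BY NAME; no estimate of Bałaban's is re-derived.  The LOWER FORM LETTER `γ‖v‖² ≤ ⟨v,Tv⟩`
is a HYPOTHESIS: in print it is [Balaban1984PropagatorsII] (2.153)∕(2.157) at trivial background U = 1 (tree, by name: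
`B6.bound2157`, `B6LowerBound2153Torus.lowerBound2153_tor`, `B6Jacobian2155Torus.ineq_2157_lam_deltaPol`, γ′₀ =
(γ₀∕(12d²))L^{−d−1}) and [Balaban1985BackgroundPropagators] p. 428's ASSERTED «lower bound γ₀ > 0 independent of k and U»
at a curved background (cell GAPS G-B9-09: asserted, proved nowhere in print; tree `B9SectEKernel.gamma0_assembly` carries
its logic) — NODE N06 ∕ [B9] territory, consumed here as a letter, not derived.  One finite T⁴ programme at fixed ε;
nothing here is a claim about the continuum, ℝ⁴, OS axioms, a mass gap or the Clay problem.

CITATION HEADER (lean-in-tree rule).  T. Bałaban, *Convergent renormalization expansions for lattice gauge theories*,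
Commun. Math. Phys. **119** (1988) 243–285, doi:10.1007/bf01217741 [Balaban1988Convergent] (cell paper B14 = «[III]»; held
text `paper:balaban1988-cmp119-convergent-renormalization`, journal page = PDF page + 242; pp. 273–274 [PDF 31–32] read
from the text layer by the author of this file, 2026-08-26).  THE PRINT, verbatim.  p. 273: *«−½ log det(C*Δ^{(k)}C) =
−½ Tr log(C*Δ^{(k)}C) = (1∕4πi) ∫_γ dz log z Tr(C*Δ^{(k)}C − zI)⁻¹, (3.34) where the contour γ surrounds the spectrum of
C*Δ^{(k)}C, e.g. we take γ composed of a segment of the circle |z| = R for R large enough, and of an interval on the line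
Re z = r, r positive and small. We take λ₀ > r, but small enough, and we expand the resolvent in (3.34) as follows:
(3.35)»*; p. 274: *«The integral of the first term on the right-hand side is equal to −½ log λ₀ I. … Let us introduce the
following definition: 𝐄₀^{(k+1)}(Λ_{k+1}, U_{k+1}, b) = χ_{Λ^{(k)*}_{k+1}}(b)[−½ log λ₀ − ½ ∫₀^∞ dλ (λ₀+λ)⁻¹ tr((C*Δ^{(k)}C −
λ₀I)(C*Δ^{(k)}C + λI)⁻¹)(b, b) + …] + … (3.37)»* (sign of the integral as CORRECTED in the tree, `B14LogDet336Matrix`,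
erratum G-B14-02).  [Balaban1984PropagatorsII] (CMP **96** (1984) 223–250) p. 250: *«The inequality (2.153) implies
⟨B′, C*Δ_kCB′⟩ ≥ (γ₀∕(12d²))L^{−d−1}‖CB′‖² ≥ γ′₀‖B′‖² (2.157) … C is a short-ranged operator, so C*Δ_kC has the same
exponential decay as Δ_k»*.  [Balaban1985BackgroundPropagators] (CMP **99** (1985) 389–434) p. 428: *«It is more
convenient to work with the operator C̃^{(k)}(Λ), because it is defined by a positive definite operator C*Δ_kC with a lower
bound γ₀ > 0 independent of k and U. We have proved it in [4], Lemma 2.4, for operators with U = 1. Localizing the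
operators in Δ_k and using the methods of Sect. B we can prove it for C*Δ_kC with an arbitrary configuration U»*.

BY NAME AND UNCHANGED.  `…QGQInverse.Coercive` (`γ‖v‖² ≤ ⟨v, Sv⟩`); `…B13Sqrt27.posDef_of_coercive`,
`eigenvalues_le_of_form_le`; `…B9SectEKernel.coercive_sandwich_of_range`, `form_sandwich_le` (the (2.157) ∕ B10 p. 272
sandwiches); `…B14.Eq334Contour.eq334_contour` ((3.34)₂ on a circle around the spectrum); `…B14LogDet336Matrix.log_apply_eq_sum`,
`eigenvectorUnitary_row_sum_sq`, `integral_337_diag`; `…B14.Eq339Covariance.gauss337` (the first bracket of (3.37) at a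
bond), `…B14.Eq338Concrete.gauss337_eq_fiber`.

WHAT THIS FILE PROVES (0 `sorry`, 0 `def`, standard axioms).
* §1 **the spectral window** (p. 273 «the contour γ surrounds the spectrum»): for `T` real symmetric with the lower form
  letter `QGQInverse.Coercive T γ` and an upper form letter `⟨v,Tv⟩ ≤ Γ‖v‖²`, every eigenvalue lies in `[γ, Γ]`
  (`eigenvalues_mem_Icc`); hence THE CONTOUR DATA OF (3.34) WITH MARGIN: for ANY `0 < r < γ` and `R₀ > Γ` the circle through
  `r` and `R₀` (centre `(r+R₀)∕2`, radius `(R₀−r)∕2` — print's «e.g.» contour replaced by the tree's circle) surrounds the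
  spectrum in the right half-plane (`eigenvalues_mem_Ioo_circle`), and (3.34)₂ holds on it, **`eq334_of_window`**
  (`B14.Eq334Contour.eq334_contour` BY NAME) — «r positive and small» = any `r ∈ ]0, γ[`.
* §2 **the window of `CᵀΔC` from the (2.153)∕(2.157) letters** ([Balaban1984PropagatorsII] p. 250): Δ bounded below by
  `γ` on an admissible subspace containing the range of `C`, `‖Cv‖ ≥ ‖v‖`, Δ ≤ Γ₁, `‖Cv‖² ≤ c‖v‖²` ⟹ `CᵀΔC` symmetric with
  window `[γ, Γ₁c]` (`window_transpose_mul_mul`: symmetry ∧ lower ∧ upper letter; `eigenvalues_transpose_mul_mul_mem_Icc`;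
  the sandwiches are `B9SectEKernel`'s).
* §3 **the first bracket of (3.37) per bond, λ₀-INDEPENDENT, and its size**: `gauss337_eq_neg_half_sum_logDiag` — for every
  `λ₀ > 0`, `gauss337 T λ₀ bond b = −½ Σ_{i ∈ fibre b} (log T)(i,i)` («We take λ₀ > r, but small enough» costs nothing in
  the bond total; from `integral_337_diag`); `logDiag_mem_Icc` — `log γ ≤ (log T)(i,i) ≤ log Γ` (the diagonal of `log T` is
  a convex combination of the log-eigenvalues); **`abs_gauss337_le`** — `|gauss337 T λ₀ bond b| ≤ ½·#fibre(b)·max(|log γ|,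
  |log Γ|)`: the O(1)-per-bond amplitude of the log-det piece of 𝐄₀^{(k+1)}(Λ_{k+1}, b) implied by the window, uniform in
  whatever the letters are uniform in (print: k, U, T_η, the sequences of domains).

HONEST SCOPE.  (1) Everything is finite-dimensional linear algebra + the cited tree theorems; the form letters are
hypotheses (sources above).  (2) Print's contour is «a segment of the circle |z| = R … and an interval on the line Re z = r»;
the tree's (3.34)₂ (`eq334_contour`) integrates over a full circle in `Re z > 0` — homologous around the spectrum, the
integrand being holomorphic off the spectrum in the slit plane; the deformation itself is not typed.  (3) The localized
(random-walk) form of the log-det piece (p. 278, last paragraph) is not touched.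

## References
* [Balaban1988Convergent] T. Bałaban, Commun. Math. Phys. **119** (1988) 243–285: (3.34)–(3.37) pp. 273–274.
* [Balaban1984PropagatorsII] T. Bałaban, Commun. Math. Phys. **96** (1984) 223–250: (2.153) p. 249, (2.155)–(2.157) p. 250.
* [Balaban1985BackgroundPropagators] T. Bałaban, Commun. Math. Phys. **99** (1985) 389–434: Sect. E p. 428 (after (3.158)).
-/

noncomputable section

open MeasureTheory Set Finset Matrix Complex
open scoped Real BigOperators

namespace Literature.MathematicalPhysics.QuantumFieldTheory.Balaban1983to89.B14.Eq334SpectralWindow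

open Literature.MathematicalPhysics.QuantumFieldTheory.Balaban1983to89
open B14.Eq339Covariance B14.Eq338Concrete

variable {n : Type*} [Fintype n] [DecidableEq n] {T : Matrix n n ℝ}

/-! ## §1  The spectral window and the contour data of (3.34) with a margin -/

/-- A lower Rayleigh letter bounds every eigenvalue from below: `QGQInverse.Coercive T γ → γ ≤ μ_k` (cf. `B10Eq35Norm.le_eigenvalues_of_le_form`,
re-derived to keep this leaf's imports minimal). [folklore] -/
private theorem le_eigenvalues_of_coercive (hT : T.IsHermitian) {γ : ℝ} (h : QGQInverse.Coercive T γ) (k : n) :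
    γ ≤ hT.eigenvalues k := by
  have hu : (⇑(hT.eigenvectorBasis k) : n → ℝ) ⬝ᵥ ⇑(hT.eigenvectorBasis k) = 1 := by
    have h1 := hT.eigenvectorBasis.orthonormal.1 k
    rw [EuclideanSpace.norm_eq, Real.sqrt_eq_one] at h1
    simpa [dotProduct, pow_two] using h1
  rw [hT.eigenvalues_eq k, RCLike.re_to_real, star_trivial]
  calc γ = γ * ((⇑(hT.eigenvectorBasis k) : n → ℝ) ⬝ᵥ ⇑(hT.eigenvectorBasis k)) := by rw [hu, mul_one]
    _ ≤ _ := h _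

/-- **The spectral window** (p. 273: *«the contour γ surrounds the spectrum of C*Δ^{(k)}C»*): for a real symmetric `T` with
the lower form letter `γ‖v‖² ≤ ⟨v, Tv⟩` ((2.157) [Balaban1984PropagatorsII] ∕ [Balaban1985BackgroundPropagators] p. 428) and an
upper form letter `⟨v, Tv⟩ ≤ Γ‖v‖²`, every eigenvalue of `T` lies in `[γ, Γ]`. [cite: Balaban1988Convergent, (3.34) p.273] -/
theorem eigenvalues_mem_Icc (hT : T.IsHermitian) {γ Γ : ℝ} (hlow : QGQInverse.Coercive T γ)
    (hup : ∀ v : n → ℝ, v ⬝ᵥ (T *ᵥ v) ≤ Γ * (v ⬝ᵥ v)) (k : n) :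
    hT.eigenvalues k ∈ Set.Icc γ Γ :=
  ⟨le_eigenvalues_of_coercive hT hlow k, B13Sqrt27.eigenvalues_le_of_form_le hT hup k⟩

/-- **The contour data WITH MARGIN** (p. 273: *«e.g. we take γ composed of a segment of the circle |z| = R for R large
enough, and of an interval on the line Re z = r, r positive and small»*): under the window `[γ, Γ]`, for ANY `r < γ` and
`R₀ > Γ` the circle of centre `(r + R₀)∕2` and radius `(R₀ − r)∕2` (through `r` and `R₀` on the real axis) contains every
eigenvalue in its interior. [cite: Balaban1988Convergent, (3.34) p.273] -/
theorem eigenvalues_mem_Ioo_circle (hT : T.IsHermitian) {γ Γ r R₀ : ℝ} (hlow : QGQInverse.Coercive T γ)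
    (hup : ∀ v : n → ℝ, v ⬝ᵥ (T *ᵥ v) ≤ Γ * (v ⬝ᵥ v)) (hr : r < γ) (hR₀ : Γ < R₀) (k : n) :
    hT.eigenvalues k ∈ Set.Ioo ((r + R₀) / 2 - (R₀ - r) / 2) ((r + R₀) / 2 + (R₀ - r) / 2) := by
  obtain ⟨h1, h2⟩ := eigenvalues_mem_Icc hT hlow hup k
  constructor <;> linarith

/-- **(3.34)₂ ON THE CONTOUR CHOSEN FROM THE LETTERS** (p. 273): for `T` (= C*Δ^{(k)}C, on a non-empty set of fluctuation
variables) real symmetric with `γ‖v‖² ≤ ⟨v,Tv⟩`, `γ > 0`, and `⟨v,Tv⟩ ≤ Γ‖v‖²`, and for ANY `0 < r < γ`, `R₀ > Γ`:  `T` is positive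
definite (`B13Sqrt27.posDef_of_coercive`) and `(1∕(4πi)) ∮_{|z − (r+R₀)∕2| = (R₀−r)∕2} dz log z · Tr(T − zI)⁻¹ = −½ log det T` —
`B14.Eq334Contour.eq334_contour` BY NAME on the circle of `eigenvalues_mem_Ioo_circle` (it lies in `Re z > 0` since `r > 0`).
«r positive and small» = any `r ∈ ]0, γ[`; the margin `γ − r` is what the letters buy. [cite: Balaban1988Convergent, (3.34) p.273] -/
theorem eq334_of_window [Nonempty n] (hT : T.IsHermitian) {γ Γ r R₀ : ℝ} (hγ : 0 < γ) (hlow : QGQInverse.Coercive T γ)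
    (hup : ∀ v : n → ℝ, v ⬝ᵥ (T *ᵥ v) ≤ Γ * (v ⬝ᵥ v)) (hr0 : 0 < r) (hr : r < γ) (hR₀ : Γ < R₀) :
    (1 / (4 * π * I)) * (∮ z in C((((r + R₀) / 2 : ℝ) : ℂ), (R₀ - r) / 2),
        Complex.log z * ((T.map (algebraMap ℝ ℂ)) - z • (1 : Matrix n n ℂ))⁻¹.trace) =
      -(1 / 2 : ℂ) * (Real.log T.det : ℂ) := by
  have hpd : T.PosDef := B13Sqrt27.posDef_of_coercive hT hγ hlow
  have hk := eigenvalues_mem_Icc hT hlow hup (Classical.arbitrary n)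
  have hΓ : γ ≤ Γ := hk.1.trans hk.2
  have h := B14.Eq334Contour.eq334_contour hpd (c := (r + R₀) / 2) (R := (R₀ - r) / 2) (by linarith) (by linarith)
    (fun k => eigenvalues_mem_Ioo_circle hT hlow hup hr hR₀ k)
  simpa using h

/-! ## §2  The window of `CᵀΔC` from the (2.153)∕(2.157) letters -/

section Sandwich

variable {m : Type*} [Fintype m] {p : Type*} [Fintype p] [DecidableEq p]

omit [DecidableEq p] in
/-- **The window of `C*Δ_kC` from the letters of [Balaban1984PropagatorsII] (2.153)∕(2.157)** (p. 250: *«The inequality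
(2.153) implies ⟨B′, C*Δ_kCB′⟩ ≥ (γ₀∕(12d²))L^{−d−1}‖CB′‖² ≥ γ′₀‖B′‖² (2.157)»*; B10 p. 272 «γ₁ is an upper bound of the
positive, bounded operator C*Δ_kC»): for `Δ` real symmetric, bounded below by `γ ≥ 0` on an admissible subspace `good`
containing the range of `C` and bounded above by `Γ₁ ≥ 0`, and `C` with `‖v‖² ≤ ‖Cv‖² ≤ c‖v‖²`, the sandwich `CᵀΔC` is real
symmetric with the window letters `γ‖v‖² ≤ ⟨v, CᵀΔCv⟩ ≤ Γ₁c‖v‖²` (`B9SectEKernel.coercive_sandwich_of_range` ∕ `form_sandwich_le`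
BY NAME). [cite: Balaban1984PropagatorsII, (2.157) p.250] -/
theorem window_transpose_mul_mul (Δ : Matrix m m ℝ) (hΔ : Δ.IsHermitian) (C : Matrix m p ℝ) (good : (m → ℝ) → Prop)
    {γ Γ₁ c : ℝ} (hγ : 0 ≤ γ) (hΓ₁ : 0 ≤ Γ₁) (hgood : ∀ v : p → ℝ, good (C *ᵥ v))
    (hC : ∀ v : p → ℝ, v ⬝ᵥ v ≤ (C *ᵥ v) ⬝ᵥ (C *ᵥ v)) (hC' : ∀ v : p → ℝ, (C *ᵥ v) ⬝ᵥ (C *ᵥ v) ≤ c * (v ⬝ᵥ v))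
    (hlow : ∀ B : m → ℝ, good B → γ * (B ⬝ᵥ B) ≤ B ⬝ᵥ (Δ *ᵥ B)) (hup : ∀ u : m → ℝ, u ⬝ᵥ (Δ *ᵥ u) ≤ Γ₁ * (u ⬝ᵥ u)) :
    (Cᵀ * Δ * C).IsHermitian ∧ QGQInverse.Coercive (Cᵀ * Δ * C) γ ∧
      ∀ v : p → ℝ, v ⬝ᵥ ((Cᵀ * Δ * C) *ᵥ v) ≤ Γ₁ * c * (v ⬝ᵥ v) := by
  refine ⟨?_, B9SectEKernel.coercive_sandwich_of_range Δ C good hγ hgood hC hlow,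
    B9SectEKernel.form_sandwich_le Δ C hΓ₁ hup hC'⟩
  have h := Matrix.isHermitian_conjTranspose_mul_mul C hΔ
  rwa [Matrix.conjTranspose_eq_transpose_of_trivial] at h

/-- Hence the spectral window of `C*Δ_kC`: every eigenvalue of `CᵀΔC` lies in `[γ, Γ₁c]` — with (2.157)'s `γ = γ′₀ =
(γ₀∕(12d²))L^{−d−1}` at U = 1 (tree: `B6.bound2157`, `B6LowerBound2153Torus.lowerBound2153_tor`), resp. the asserted `γ₀` of
[Balaban1985BackgroundPropagators] p. 428 at a curved background (GAPS G-B9-09). [cite: Balaban1984PropagatorsII, (2.157) p.250] -/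
theorem eigenvalues_transpose_mul_mul_mem_Icc (Δ : Matrix m m ℝ) (hΔ : Δ.IsHermitian) (C : Matrix m p ℝ)
    (good : (m → ℝ) → Prop) {γ Γ₁ c : ℝ} (hγ : 0 ≤ γ) (hΓ₁ : 0 ≤ Γ₁) (hgood : ∀ v : p → ℝ, good (C *ᵥ v))
    (hC : ∀ v : p → ℝ, v ⬝ᵥ v ≤ (C *ᵥ v) ⬝ᵥ (C *ᵥ v)) (hC' : ∀ v : p → ℝ, (C *ᵥ v) ⬝ᵥ (C *ᵥ v) ≤ c * (v ⬝ᵥ v))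
    (hlow : ∀ B : m → ℝ, good B → γ * (B ⬝ᵥ B) ≤ B ⬝ᵥ (Δ *ᵥ B)) (hup : ∀ u : m → ℝ, u ⬝ᵥ (Δ *ᵥ u) ≤ Γ₁ * (u ⬝ᵥ u))
    (k : p) :
    (window_transpose_mul_mul Δ hΔ C good hγ hΓ₁ hgood hC hC' hlow hup).1.eigenvalues k ∈ Set.Icc γ (Γ₁ * c) := by
  obtain ⟨hH, hco, hupper⟩ := window_transpose_mul_mul Δ hΔ C good hγ hΓ₁ hgood hC hC' hlow hup
  exact eigenvalues_mem_Icc hH hco hupper k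

end Sandwich

/-! ## §3  The first bracket of (3.37) per bond: λ₀-independence and size -/

section Gauss

variable {β : Type*} [DecidableEq β]

/-- **The first bracket of (3.37) at the bond `b` IS `−½ tr(log T)(b, b)`, for EVERY `λ₀ > 0`** (p. 274; the tree's
corrected sign): `gauss337 T λ₀ bond b = −½ Σ_{i ∈ fibre b} (log T)(i, i)` — by `B14LogDet336Matrix.integral_337_diag`
(`∫₀^∞ dλ (λ₀+λ)⁻¹((T − λ₀I)(T + λI)⁻¹)(i,i) = (log T)(i,i) − log λ₀`) summed over the fibre; the `log λ₀` terms cancel, so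
print's «We take λ₀ > r, but small enough» is immaterial for the per-bond totals (it matters only for the resolvent
expansion (3.35)). [cite: Balaban1988Convergent, (3.37) p.274] -/
theorem gauss337_eq_neg_half_sum_logDiag (hT : T.PosDef) {lam0 : ℝ} (h0 : 0 < lam0) (bond : n → β) (b : β) :
    gauss337 T lam0 bond b = -(1 / 2 : ℝ) * ∑ i ∈ univ.filter (fun i => bond i = b), (cfc Real.log T) i i := by
  rw [gauss337_eq_fiber]
  have hI : ∫ x in Ioi (0 : ℝ), (lam0 + x)⁻¹
        * ∑ i ∈ univ.filter (fun i => bond i = b), ((T - lam0 • (1 : Matrix n n ℝ)) * (T + x • 1)⁻¹) i i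
      = ∑ i ∈ univ.filter (fun i => bond i = b), ((cfc Real.log T) i i - Real.log lam0) := by
    rw [← Finset.sum_congr rfl fun i _ => (B14LogDet336Matrix.integral_337_diag hT h0 i).2,
      ← integral_finsetSum _ (fun i _ => (B14LogDet336Matrix.integral_337_diag hT h0 i).1)]
    refine setIntegral_congr_fun measurableSet_Ioi fun x _ => ?_
    simp only [Finset.mul_sum]
  rw [hI, Finset.sum_sub_distrib, Finset.sum_const, nsmul_eq_mul]
  ring

/-- The diagonal of `log T` as a convex combination of the log-eigenvalues: `(log T)(i,i) = Σ_k V_{ik}² log μ_k`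
(`B14LogDet336Matrix.log_apply_eq_sum`). [folklore] -/
private theorem logDiag_eq_sum_sq (hT : T.PosDef) (i : n) :
    (cfc Real.log T) i i = ∑ k, (hT.1.eigenvectorUnitary : Matrix n n ℝ) i k ^ 2 * Real.log (hT.1.eigenvalues k) := by
  rw [B14LogDet336Matrix.log_apply_eq_sum hT i i]
  exact Finset.sum_congr rfl fun k _ => by ring

/-- **The window controls the diagonal of `log(C*Δ^{(k)}C)`**: with `γ‖v‖² ≤ ⟨v,Tv⟩`, `γ > 0`, `⟨v,Tv⟩ ≤ Γ‖v‖²`, every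
diagonal entry satisfies `log γ ≤ (log T)(i, i) ≤ log Γ` (a convex combination `Σ_k V_{ik}² log μ_k`, `Σ_k V_{ik}² = 1`,
of log-eigenvalues in `[log γ, log Γ]`). [cite: Balaban1988Convergent, (3.37) p.274] -/
theorem logDiag_mem_Icc (hT : T.IsHermitian) {γ Γ : ℝ} (hγ : 0 < γ) (hlow : QGQInverse.Coercive T γ)
    (hup : ∀ v : n → ℝ, v ⬝ᵥ (T *ᵥ v) ≤ Γ * (v ⬝ᵥ v)) (i : n) :
    (cfc Real.log T) i i ∈ Set.Icc (Real.log γ) (Real.log Γ) := by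
  have hpd : T.PosDef := B13Sqrt27.posDef_of_coercive hT hγ hlow
  have hw : ∑ k, (hpd.1.eigenvectorUnitary : Matrix n n ℝ) i k ^ 2 = 1 :=
    B14LogDet336Matrix.eigenvectorUnitary_row_sum_sq hpd.1 i
  have hμ : ∀ k, hpd.1.eigenvalues k ∈ Set.Icc γ Γ := fun k => eigenvalues_mem_Icc hpd.1 hlow hup k
  have hlog : ∀ k, Real.log (hpd.1.eigenvalues k) ∈ Set.Icc (Real.log γ) (Real.log Γ) := fun k =>
    ⟨Real.log_le_log hγ (hμ k).1, Real.log_le_log (lt_of_lt_of_le hγ (hμ k).1) (hμ k).2⟩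
  rw [logDiag_eq_sum_sq hpd i]
  constructor
  · calc Real.log γ = ∑ k, (hpd.1.eigenvectorUnitary : Matrix n n ℝ) i k ^ 2 * Real.log γ := by
          rw [← Finset.sum_mul, hw, one_mul]
      _ ≤ _ := Finset.sum_le_sum fun k _ => mul_le_mul_of_nonneg_left (hlog k).1 (sq_nonneg _)
  · calc _ ≤ ∑ k, (hpd.1.eigenvectorUnitary : Matrix n n ℝ) i k ^ 2 * Real.log Γ :=
          Finset.sum_le_sum fun k _ => mul_le_mul_of_nonneg_left (hlog k).2 (sq_nonneg _)
      _ = Real.log Γ := by rw [← Finset.sum_mul, hw, one_mul]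

/-- Consequently `|(log T)(i, i)| ≤ max(|log γ|, |log Γ|)`. [cite: Balaban1988Convergent, (3.37) p.274] -/
theorem abs_logDiag_le (hT : T.IsHermitian) {γ Γ : ℝ} (hγ : 0 < γ) (hlow : QGQInverse.Coercive T γ)
    (hup : ∀ v : n → ℝ, v ⬝ᵥ (T *ᵥ v) ≤ Γ * (v ⬝ᵥ v)) (i : n) :
    |(cfc Real.log T) i i| ≤ max |Real.log γ| |Real.log Γ| := by
  obtain ⟨h1, h2⟩ := logDiag_mem_Icc hT hγ hlow hup i
  exact abs_le_max_abs_abs h1 h2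

/-- **THE PER-BOND SIZE OF THE LOG-DET PIECE OF 𝐄₀^{(k+1)}(Λ_{k+1}, b)** ((3.37)₁ p. 274; the quantity p. 278 localizes by
«the generalized random walk expansions» with «terms satisfying (2.42)»): under the window letters `γ‖v‖² ≤ ⟨v,Tv⟩`, `γ > 0`,
`⟨v,Tv⟩ ≤ Γ‖v‖²` for `T = C*Δ^{(k)}C`, and for EVERY `λ₀ > 0`,
`|gauss337 T λ₀ bond b| ≤ ½ · #fibre(b) · max(|log γ|, |log Γ|)` — uniform in whatever the letters are uniform in
(print: k, U, T_η, the sequences of domains). [cite: Balaban1988Convergent, (3.37) p.274] -/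
theorem abs_gauss337_le (hT : T.IsHermitian) {γ Γ : ℝ} (hγ : 0 < γ) (hlow : QGQInverse.Coercive T γ)
    (hup : ∀ v : n → ℝ, v ⬝ᵥ (T *ᵥ v) ≤ Γ * (v ⬝ᵥ v)) {lam0 : ℝ} (h0 : 0 < lam0) (bond : n → β) (b : β) :
    |gauss337 T lam0 bond b| ≤
      (1 / 2 : ℝ) * (#(univ.filter fun i => bond i = b) : ℝ) * max |Real.log γ| |Real.log Γ| := by
  have hpd : T.PosDef := B13Sqrt27.posDef_of_coercive hT hγ hlow
  rw [gauss337_eq_neg_half_sum_logDiag hpd h0 bond b, abs_mul]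
  have hhalf : |(-(1 / 2 : ℝ))| = 1 / 2 := by norm_num
  rw [hhalf, mul_assoc]
  refine mul_le_mul_of_nonneg_left ?_ (by norm_num)
  calc |∑ i ∈ univ.filter (fun i => bond i = b), (cfc Real.log T) i i|
      ≤ ∑ i ∈ univ.filter (fun i => bond i = b), |(cfc Real.log T) i i| := Finset.abs_sum_le_sum_abs _ _
    _ ≤ ∑ _i ∈ univ.filter (fun i => bond i = b), max |Real.log γ| |Real.log Γ| :=
        Finset.sum_le_sum fun i _ => abs_logDiag_le hT hγ hlow hup i
    _ = (#(univ.filter fun i => bond i = b) : ℝ) * max |Real.log γ| |Real.log Γ| := by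
        rw [Finset.sum_const, nsmul_eq_mul]

end Gauss

end Literature.MathematicalPhysics.QuantumFieldTheory.Balaban1983to89.B14.Eq334SpectralWindow

end
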